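import Summits.BirchSwinnertonDyer.BirchSwinnertonDyer.Theorems.QuadraticBranchSignedControlPlusEtaNonsurjConjADoorUnit
import Summits.BirchSwinnertonDyer.BirchSwinnertonDyer.Theorems.QuadraticBranchSignedControlPlusEtaNonsurjConjADoorHeckeRecordsA
import Summits.BirchSwinnertonDyer.Rank1Residual.X11b.ChaPairsMinimality
import HarnessLib

/-!
# Route `QuadraticBranchSignedControl` (rung K8, cell `bsd-potss`), residual crux `PlusEtaMainConjectureNonsurj`
# (stmt-BirchSwinnertonDyer-19606): FAMILY RECORDS D — (C1⁺_η)@5 BY NAME through door L4 (Hecke TWIST) on four congruent-class family rows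
# whose eigenline the census «killed by S-classes» only at a (c3)-FAILING prime: c5b:−23 (unit), c5e:37, c5a:−19, c5d:8 (prime-`L` rank one)
# (seat `bsd-potss-k8eta-c2` g22; data k8eta-c2 g21 kits j326606 / j327196, GRH)

WHAT. In g21's family census (65 congruent-class rows) nine rows carried «PASS-L3(S-classes)»; this seat's (c3) check (kit j330635) shows the
killing classes lie above a multiplicative prime `ℓ ∈ {29, 241, 271, 31, 59, 11}` with `W(ℚ_ℓ)[5] ≠ 0` — (c3) FAILS, so the `S`-split door is VOID
there (no theorem licenses it; kernel reason `EtaConjADoorSplit.apply_mk0_eq_zero_of_decomp`, p716503). But five of the nine have g21 Hecke verdict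
TWIST (`T_y = −Tr` on the tautological line: it belongs to `ρ̄ ⊗ ε′`, (c2) for `W` HOLDS) — door L4 passes INDEPENDENTLY of `S`. Four of those
five have a record shape and are instantiated here: `etaMC_unit_c5b_m23_5_of_heckeEigenHom` (unit row: `ε = +1`, `λ⁺ = μ⁺ = 0`, `r_an = 0`; the
unit-row door p715862) and `etaMC_r1_{c5e_37, c5a_m19, c5d_8}_5_of_heckeEigenHom` (prime-`L` rank one: `ε = −1`, `λ⁺ = 1`, `μ⁺ = 0`, `r_an = 1`;
g21's `EtaConjADoorHeckeRecords.etaMC_r1_of_heckeEigenHom`, p707571); the fifth, c5e:−19, has `r_an = 2` (no record shape). These are CONGRUENT-class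
rows (bases `A = [0,0,0,−3135,−40138]` (c5b), `[0,0,0,−104280,−12025372]` (c5e), `[0,0,0,−345,5157]` (c5a), `[0,0,1,−46110,3870549]` (c5d); in-table
partner conductors 78300, 243900, 26100, 162675): covered IN SHAPE by v7's CL25-transfer branch — these records are binder-free.
ERRATUM (docstrings only, statements unaffected): in p716999 / p719462 the base of family c5f is misnamed; the c5f base row curve is
`A = [0,0,1,−840,362]` (partner conductor 341775), and c5e's is `[0,0,0,−104280,−12025372]` (243900).

HONEST FRAMING (cell `bsd-potss`; FULL-BSD rank ≤ 1 programme, HUMAN RULING D-0036/D-0074): per-row RECORDS, CONDITIONAL on the displayed named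
facts (`h22 h41 h6273` [+ `hGZK` on rank one]) and per-row inputs (tower clause, unit certificate resp. `r_an = 1` and `(L_5⁺) = (X)`, the
Hecke-refined eigen datum); GRH numerics are evidence, not facts; no stub of 19606 proved; crux and route OPEN; nothing booked; `BSD(W,5)` claimed for
no pair. `--supports stmt-BirchSwinnertonDyer-19606`.

References: [Kobayashi2003] Thm. 2.2, §4, Thm. 4.1; [CoatesSujatha2005] §3 (A); [DeoRaySujatha2023] Thm. 3.8–3.9; [Zywina2015] Thm. 1.4.
-/

set_option autoImplicit false
set_option linter.dupNamespace false
noncomputable section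

open scoped Classical nonZeroDivisors

open CongruenceSubgroup NumberField Field WeierstrassCurve
open Literature.NumberTheory.EllipticCurves Literature.NumberTheory.EllipticCurves.ModularForms
  Literature.NumberTheory.EllipticCurves.Rank1Residual Literature.NumberTheory.EllipticCurves.Rank1Residual.Typed
  Literature.NumberTheory.GaloisRepresentations Literature.NumberTheory.GaloisCohomology Literature.NumberTheory.NumberFields
  Literature.NumberTheory.EllipticCurves.GreenbergVatsal2000 ZpExtension
open Summit.BirchSwinnertonDyer.Rank1Residual Summit.BirchSwinnertonDyer.Rank1Residual.Additive
open Summit.BirchSwinnertonDyer.Rank1Residual.X11b (isElliptic_of_discOf_ne_zero)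
open Summit.BirchSwinnertonDyer.BirchSwinnertonDyer.Theorems
open Summit.BirchSwinnertonDyer.Rank1Residual.X11b (isElliptic_of_discOf_ne_zero)
open Summit.BirchSwinnertonDyer.BirchSwinnertonDyer.Theorems.EtaConjADoorUnit (quadraticBranchPlusEtaMainConjectureAt_of_heckeEigenHom_of_isUnit)
open Summit.BirchSwinnertonDyer.BirchSwinnertonDyer.Theorems.EtaConjADoorHeckeRecords (etaMC_r1_of_heckeEigenHom)

namespace Summit.BirchSwinnertonDyer.BirchSwinnertonDyer.Theorems.EtaConjADoorFamilyRecords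

/-- The `5`-partner of c5b:-23, `W = [0, 0, 0, -41460375, 61044880750]` (non-CM, `N_W = 41420700`; `j(W) = j(A)` for the quadratic twist `A^{(-23)}`
of `A = [0,0,0,−3135,−40138]` (non-CM in-table row curve of partner conductor `78300`, `5`-CONGRUENT to a CM row of the crux — k8eta-c2 g8;
CL25-transfer class, here settled binder-free)): `Δ ≠ 0` (kernel). [cite: Zywina2015, Thm. 1.4] -/
theorem isElliptic_c5b_m23 : (⟨0, 0, 0, (-41460375), 61044880750⟩ : WeierstrassCurve ℚ).IsElliptic :=
  isElliptic_of_discOf_ne_zero 0 0 0 (-41460375) 61044880750 (by decide +kernel)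

/-- **(C1⁺_η) at `p = 5` for every good `a_5 = 0` model `V` of the `5`-twist of the CONGRUENT-class UNIT partner c5b:-23** (`W = [0, 0, 0,
-41460375, 61044880750]`, non-CM, `N_W = 41420700`; kit j326606/j327196 (k8eta-c2 g21) (190+804 s, GRH): `ε(W) = +1`, PARI plus-`η` `(λ, μ) = (0,
0)` — `L_5⁺(V,η,T)` is a UNIT of `Λ` —, `r_an(W) = 0` (`ellanalyticrank`); `h(ℚ(P)) = 60` (`[30,2]`); eigen dimensions `(d₁,d₂,d₃,d₄) = (0,1,0,0)`;
Hecke datum (conjA g13 hecke13 engine, kit j327196): `Tr ρ̄(y) = 3`, `T_y` acts on the tautological line by `c = 2` — verdict TWIST-TYPE (`T_y =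
−Tr`: the line belongs to `ρ̄ ⊗ ε′`, not to `ρ̄`; (c2) for `W` holds) — door L4 (Hecke-refined eigen-test) passes) from the ROW ALONE — named facts
`h22 h41 h6273` ONLY (no `hGZK`, no `r_an`, no `L₀`); displayed: the tower clause, the unit certificate «every `L_5⁺(V,η,T)` is a unit», the
class-group datum. Instance of `EtaConjADoorUnit.quadraticBranchPlusEtaMainConjectureAt_of_heckeEigenHom_of_isUnit` (k8eta-c2 g22, p715862).
CONDITIONAL; nothing booked. [cite: Kobayashi2003, §4 (p. 8), Thm. 2.2 (p. 5)] [cite: CoatesSujatha2005, §3 (A) and Thm. 3.4] [cite: Zywina2015,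
Thm. 1.4] -/
theorem etaMC_unit_c5b_m23_5_of_heckeEigenHom
    (h22 : Kobayashi2003.thm22_etaSignedSelmerDual_finite_torsion)
    (h41 : Kobayashi2003.thm41_plusEtaCharIdeal_dvd)
    (h6273 : Kobayashi2003.thm62_63_73_etaColemanPoitouTate) [Fact (5 : ℕ).Prime]
    (W : WeierstrassCurve ℚ) (hW : W = (⟨0, 0, 0, (-41460375), 61044880750⟩ : WeierstrassCurve ℚ))
    (V : WeierstrassCurve ℚ) [V.IsElliptic] [V.IsGloballyMinimal] (C : VariableChange ℚ)
    (hC : C • W.quadraticTwist 5 = V)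
    (hgood : V.HasGoodReductionAtPrime 5) (hap : V.frobeniusTrace 5 = 0)
    (hns : ¬ ∀ m : ℕ, V.HasSurjectiveModNGaloisRep (5 ^ m : ℕ))
    (hunit : ∀ {N : ℕ} [NeZero N] {f : CuspForm (Gamma0 N) 2}, IsNewformOf V f →
      ∀ (ϖ : ℚ), (if Even (5 / 2) then (ϖ : ℝ) * V.realPeriodRat = plusPeriod f
          else (ϖ : ℝ) * V.imaginaryPeriodRat = minusPeriod f) →
      ∀ (Lη : IwasawaAlgebra 5), IsQuadraticBranchPlusLFunction f 5 ϖ Lη → IsUnit Lη)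
    (hP : haveI : W.IsElliptic := hW ▸ isElliptic_c5b_m23
      haveI : NeZero (5 : ℕ) := ⟨by norm_num⟩
      haveI : NumberField (W.divisionField 5) := NumberField.mk
      ∃ P : geomTorsion W ((5 : ℕ) : ℤ), P ≠ 0 ∧
        ∀ K : IntermediateField ℚ (W.divisionField 5),
          K = IntermediateField.fixedField
            ((MulAction.stabilizer (absoluteGaloisGroup ℚ) P).map (absRestrictNormalHom (W.divisionField 5))) →
        ∀ μ : Additive (ClassGroup (𝓞 K)) →+ ZMod 5,
          (∀ (τ : absoluteGaloisGroup ℚ) (σ : K ≃ₐ[ℚ] K) (a : ℕ),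
              (∀ x : K, absRestrictNormalHom (W.divisionField 5) τ (x : W.divisionField 5) =
                ((σ x : K) : W.divisionField 5)) → τ • P = a • P →
              ∀ (I J : (Ideal (𝓞 K))⁰),
                (J : Ideal (𝓞 K)) = (I : Ideal (𝓞 K)).map (AmbiguousClass.intAut σ : 𝓞 K →+* 𝓞 K) →
                μ (Additive.ofMul (ClassGroup.mk0 J)) = a • μ (Additive.ofMul (ClassGroup.mk0 I))) →
          (∀ (τ τ₁ : absoluteGaloisGroup ℚ) (a a₁ b : ℕ) (Q : geomTorsion W ((5 : ℕ) : ℤ)),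
              τ • P = a • P + Q → τ₁ • P = a₁ • P → τ₁ • Q = b • Q → (a₁ : ZMod 5) ≠ (b : ZMod 5) →
              ∀ I : (Ideal (𝓞 K))⁰,
                μ (Additive.ofMul (classGroupNorm K (W.divisionField 5) (ClassGroup.mulEquiv
                  (AmbiguousClass.intAut (absRestrictNormalHom (W.divisionField 5) τ))
                    (classGroupExtend K (W.divisionField 5) (ClassGroup.mk0 I))))) =
                  (Nat.card ((W.divisionField 5) ≃ₐ[K] (W.divisionField 5)) * a) •
                    μ (Additive.ofMul (ClassGroup.mk0 I))) →
          μ = 0) :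
    QuadraticBranchPlusEtaMainConjectureAt V 5 := by
  subst hW
  haveI : (⟨0, 0, 0, (-41460375), 61044880750⟩ : WeierstrassCurve ℚ).IsElliptic := isElliptic_c5b_m23
  haveI : NeZero (5 : ℕ) := ⟨by norm_num⟩
  exact quadraticBranchPlusEtaMainConjectureAt_of_heckeEigenHom_of_isUnit 5 V _ C h22 h41 h6273 (le_refl 5)
    (by rw [show ((-1 : ℚ) ^ ((5 : ℕ) / 2) * ((5 : ℕ) : ℚ)) = 5 by norm_num]; exact hC) hgood hap hns hP hunit

/-- The `5`-partner of c5e:37, `W = [0, 0, 0, -3568983000, -76140145989500]` (non-CM, `N_W = 333899100`; `j(W) = j(A)` for the quadratic twist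
`A^{(37)}` of `A = [0,0,0,−104280,−12025372]` (non-CM in-table row curve of partner conductor `243900`, `5`-CONGRUENT to a CM row — k8eta-c2 g8;
CL25-transfer class, here settled binder-free)): `Δ ≠ 0` (kernel). [cite: Zywina2015, Thm. 1.4] -/
theorem isElliptic_c5e_37 : (⟨0, 0, 0, (-3568983000), (-76140145989500)⟩ : WeierstrassCurve ℚ).IsElliptic :=
  isElliptic_of_discOf_ne_zero 0 0 0 (-3568983000) (-76140145989500) (by decide +kernel)

/-- **(C1⁺_η) at `p = 5` for every good `a_5 = 0` model `V` of the `5`-twist of the CONGRUENT-class prime-`L` rank-one partner c5e:37** (`W = [0, 0,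
0, -3568983000, -76140145989500]`, non-CM, `N_W = 333899100`; kit j326606/j327196 (k8eta-c2 g21) (209+1072 s, GRH): `ε(W) = −1`, PARI plus-`η` `(λ,
μ) = (1, 0)`, `r_an(W) = 1` (`k8eta-c2 g19 etanc`); `h(ℚ(P)) = 40` (`[10,2,2]`); eigen dimensions `(d₁,d₂,d₃,d₄) = (0,1,0,0)`; Hecke datum (conjA
g13 hecke13 engine, kit j327196): `Tr ρ̄(y) = 4`, `T_y` acts on the tautological line by `c = 1` — verdict TWIST-TYPE (`T_y = −Tr`: the line belongs
to `ρ̄ ⊗ ε′`, not to `ρ̄`; (c2) for `W` holds) — door L4 (Hecke-refined eigen-test) passes) from the ROW ALONE — named facts `h22 h41 h6273 hGZK`;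
displayed: `r_an(W) = 1`, the tower clause, `(L_5⁺(V,η,X)) = (X)`, the class-group datum. Instance of
`EtaConjADoorHeckeRecords.etaMC_r1_of_heckeEigenHom` (p707571). CONDITIONAL; nothing booked. [cite: Kobayashi2003, §4 (p. 8), Thm. 2.2 (p. 5)]
[cite: CoatesSujatha2005, §3 (A) and Thm. 3.4] [cite: Zywina2015, Thm. 1.4] -/
theorem etaMC_r1_c5e_37_5_of_heckeEigenHom
    (h22 : Kobayashi2003.thm22_etaSignedSelmerDual_finite_torsion)
    (h41 : Kobayashi2003.thm41_plusEtaCharIdeal_dvd)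
    (h6273 : Kobayashi2003.thm62_63_73_etaColemanPoitouTate)
    (hGZK : rank_eq_analyticRank_of_analyticRank_le_one) [Fact (5 : ℕ).Prime]
    (W : WeierstrassCurve ℚ) (hW : W = (⟨0, 0, 0, (-3568983000), (-76140145989500)⟩ : WeierstrassCurve ℚ)) (hr : W.analyticRank = 1)
    (V : WeierstrassCurve ℚ) [V.IsElliptic] [V.IsGloballyMinimal] (C : VariableChange ℚ)
    (hC : C • W.quadraticTwist 5 = V)
    (hgood : V.HasGoodReductionAtPrime 5) (hap : V.frobeniusTrace 5 = 0)
    (hns : ¬ ∀ m : ℕ, V.HasSurjectiveModNGaloisRep (5 ^ m : ℕ))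
    (hX : ∀ {N : ℕ} [NeZero N] {f : CuspForm (Gamma0 N) 2}, IsNewformOf V f →
      ∀ (ϖ : ℚ), (if Even (5 / 2) then (ϖ : ℝ) * V.realPeriodRat = plusPeriod f
          else (ϖ : ℝ) * V.imaginaryPeriodRat = minusPeriod f) →
      ∀ (Lη : IwasawaAlgebra 5), IsQuadraticBranchPlusLFunction f 5 ϖ Lη →
        Ideal.span {Lη} = Ideal.span {(PowerSeries.X : IwasawaAlgebra 5)})
    (hP : haveI : W.IsElliptic := hW ▸ isElliptic_c5e_37
      haveI : NeZero (5 : ℕ) := ⟨by norm_num⟩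
      haveI : NumberField (W.divisionField 5) := NumberField.mk
      ∃ P : geomTorsion W ((5 : ℕ) : ℤ), P ≠ 0 ∧
        ∀ K : IntermediateField ℚ (W.divisionField 5),
          K = IntermediateField.fixedField
            ((MulAction.stabilizer (absoluteGaloisGroup ℚ) P).map (absRestrictNormalHom (W.divisionField 5))) →
        ∀ μ : Additive (ClassGroup (𝓞 K)) →+ ZMod 5,
          (∀ (τ : absoluteGaloisGroup ℚ) (σ : K ≃ₐ[ℚ] K) (a : ℕ),
              (∀ x : K, absRestrictNormalHom (W.divisionField 5) τ (x : W.divisionField 5) =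
                ((σ x : K) : W.divisionField 5)) → τ • P = a • P →
              ∀ (I J : (Ideal (𝓞 K))⁰),
                (J : Ideal (𝓞 K)) = (I : Ideal (𝓞 K)).map (AmbiguousClass.intAut σ : 𝓞 K →+* 𝓞 K) →
                μ (Additive.ofMul (ClassGroup.mk0 J)) = a • μ (Additive.ofMul (ClassGroup.mk0 I))) →
          (∀ (τ τ₁ : absoluteGaloisGroup ℚ) (a a₁ b : ℕ) (Q : geomTorsion W ((5 : ℕ) : ℤ)),
              τ • P = a • P + Q → τ₁ • P = a₁ • P → τ₁ • Q = b • Q → (a₁ : ZMod 5) ≠ (b : ZMod 5) →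
              ∀ I : (Ideal (𝓞 K))⁰,
                μ (Additive.ofMul (classGroupNorm K (W.divisionField 5) (ClassGroup.mulEquiv
                  (AmbiguousClass.intAut (absRestrictNormalHom (W.divisionField 5) τ))
                    (classGroupExtend K (W.divisionField 5) (ClassGroup.mk0 I))))) =
                  (Nat.card ((W.divisionField 5) ≃ₐ[K] (W.divisionField 5)) * a) •
                    μ (Additive.ofMul (ClassGroup.mk0 I))) →
          μ = 0) :
    QuadraticBranchPlusEtaMainConjectureAt V 5 := by
  subst hW
  haveI : (⟨0, 0, 0, (-3568983000), (-76140145989500)⟩ : WeierstrassCurve ℚ).IsElliptic := isElliptic_c5e_37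
  haveI : NeZero (5 : ℕ) := ⟨by norm_num⟩
  exact etaMC_r1_of_heckeEigenHom h22 h41 h6273 hGZK 5 (le_refl 5) _ hr V C
    (by rw [show ((-1 : ℚ) ^ ((5 : ℕ) / 2) * ((5 : ℕ) : ℚ)) = 5 by norm_num]; exact hC) hgood hap hns hX hP

/-- The `5`-partner of c5a:-19, `W = [0, 0, 0, -3113625, -4421482875]` (non-CM, `N_W = 9422100`; `j(W) = j(A)` for the quadratic twist `A^{(-19)}`
of `A = [0,0,0,−345,5157]` (non-CM in-table row curve of partner conductor `26100`, `5`-CONGRUENT to a CM row of the crux — k8eta-c2 g8 kernel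
certificates; CL25-transfer class, here settled binder-free)): `Δ ≠ 0` (kernel). [cite: Zywina2015, Thm. 1.4] -/
theorem isElliptic_c5a_m19 : (⟨0, 0, 0, (-3113625), (-4421482875)⟩ : WeierstrassCurve ℚ).IsElliptic :=
  isElliptic_of_discOf_ne_zero 0 0 0 (-3113625) (-4421482875) (by decide +kernel)

/-- **(C1⁺_η) at `p = 5` for every good `a_5 = 0` model `V` of the `5`-twist of the CONGRUENT-class prime-`L` rank-one partner c5a:-19** (`W = [0,
0, 0, -3113625, -4421482875]`, non-CM, `N_W = 9422100`; kit j326606/j327196 (k8eta-c2 g21) (147+623 s, GRH): `ε(W) = −1`, PARI plus-`η` `(λ, μ) =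
(1, 0)`, `r_an(W) = 1` (`k8eta-c2 g19 etanc`); `h(ℚ(P)) = 20` (`[10,2]`); eigen dimensions `(d₁,d₂,d₃,d₄) = (0,1,0,0)`; Hecke datum (conjA g13
hecke13 engine, kit j327196): `Tr ρ̄(y) = 4`, `T_y` acts on the tautological line by `c = 1` — verdict TWIST-TYPE (`T_y = −Tr`: the line belongs to
`ρ̄ ⊗ ε′`, not to `ρ̄`; (c2) for `W` holds) — door L4 (Hecke-refined eigen-test) passes) from the ROW ALONE — named facts `h22 h41 h6273 hGZK`;
displayed: `r_an(W) = 1`, the tower clause, `(L_5⁺(V,η,X)) = (X)`, the class-group datum. Instance of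
`EtaConjADoorHeckeRecords.etaMC_r1_of_heckeEigenHom` (p707571). CONDITIONAL; nothing booked. [cite: Kobayashi2003, §4 (p. 8), Thm. 2.2 (p. 5)]
[cite: CoatesSujatha2005, §3 (A) and Thm. 3.4] [cite: Zywina2015, Thm. 1.4] -/
theorem etaMC_r1_c5a_m19_5_of_heckeEigenHom
    (h22 : Kobayashi2003.thm22_etaSignedSelmerDual_finite_torsion)
    (h41 : Kobayashi2003.thm41_plusEtaCharIdeal_dvd)
    (h6273 : Kobayashi2003.thm62_63_73_etaColemanPoitouTate)
    (hGZK : rank_eq_analyticRank_of_analyticRank_le_one) [Fact (5 : ℕ).Prime]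
    (W : WeierstrassCurve ℚ) (hW : W = (⟨0, 0, 0, (-3113625), (-4421482875)⟩ : WeierstrassCurve ℚ)) (hr : W.analyticRank = 1)
    (V : WeierstrassCurve ℚ) [V.IsElliptic] [V.IsGloballyMinimal] (C : VariableChange ℚ)
    (hC : C • W.quadraticTwist 5 = V)
    (hgood : V.HasGoodReductionAtPrime 5) (hap : V.frobeniusTrace 5 = 0)
    (hns : ¬ ∀ m : ℕ, V.HasSurjectiveModNGaloisRep (5 ^ m : ℕ))
    (hX : ∀ {N : ℕ} [NeZero N] {f : CuspForm (Gamma0 N) 2}, IsNewformOf V f →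
      ∀ (ϖ : ℚ), (if Even (5 / 2) then (ϖ : ℝ) * V.realPeriodRat = plusPeriod f
          else (ϖ : ℝ) * V.imaginaryPeriodRat = minusPeriod f) →
      ∀ (Lη : IwasawaAlgebra 5), IsQuadraticBranchPlusLFunction f 5 ϖ Lη →
        Ideal.span {Lη} = Ideal.span {(PowerSeries.X : IwasawaAlgebra 5)})
    (hP : haveI : W.IsElliptic := hW ▸ isElliptic_c5a_m19
      haveI : NeZero (5 : ℕ) := ⟨by norm_num⟩
      haveI : NumberField (W.divisionField 5) := NumberField.mk
      ∃ P : geomTorsion W ((5 : ℕ) : ℤ), P ≠ 0 ∧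
        ∀ K : IntermediateField ℚ (W.divisionField 5),
          K = IntermediateField.fixedField
            ((MulAction.stabilizer (absoluteGaloisGroup ℚ) P).map (absRestrictNormalHom (W.divisionField 5))) →
        ∀ μ : Additive (ClassGroup (𝓞 K)) →+ ZMod 5,
          (∀ (τ : absoluteGaloisGroup ℚ) (σ : K ≃ₐ[ℚ] K) (a : ℕ),
              (∀ x : K, absRestrictNormalHom (W.divisionField 5) τ (x : W.divisionField 5) =
                ((σ x : K) : W.divisionField 5)) → τ • P = a • P →
              ∀ (I J : (Ideal (𝓞 K))⁰),
                (J : Ideal (𝓞 K)) = (I : Ideal (𝓞 K)).map (AmbiguousClass.intAut σ : 𝓞 K →+* 𝓞 K) →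
                μ (Additive.ofMul (ClassGroup.mk0 J)) = a • μ (Additive.ofMul (ClassGroup.mk0 I))) →
          (∀ (τ τ₁ : absoluteGaloisGroup ℚ) (a a₁ b : ℕ) (Q : geomTorsion W ((5 : ℕ) : ℤ)),
              τ • P = a • P + Q → τ₁ • P = a₁ • P → τ₁ • Q = b • Q → (a₁ : ZMod 5) ≠ (b : ZMod 5) →
              ∀ I : (Ideal (𝓞 K))⁰,
                μ (Additive.ofMul (classGroupNorm K (W.divisionField 5) (ClassGroup.mulEquiv
                  (AmbiguousClass.intAut (absRestrictNormalHom (W.divisionField 5) τ))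
                    (classGroupExtend K (W.divisionField 5) (ClassGroup.mk0 I))))) =
                  (Nat.card ((W.divisionField 5) ≃ₐ[K] (W.divisionField 5)) * a) •
                    μ (Additive.ofMul (ClassGroup.mk0 I))) →
          μ = 0) :
    QuadraticBranchPlusEtaMainConjectureAt V 5 := by
  subst hW
  haveI : (⟨0, 0, 0, (-3113625), (-4421482875)⟩ : WeierstrassCurve ℚ).IsElliptic := isElliptic_c5a_m19
  haveI : NeZero (5 : ℕ) := ⟨by norm_num⟩
  exact etaMC_r1_of_heckeEigenHom h22 h41 h6273 hGZK 5 (le_refl 5) _ hr V C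
    (by rw [show ((-1 : ℚ) ^ ((5 : ℕ) / 2) * ((5 : ℕ) : ℚ)) = 5 by norm_num]; exact hC) hgood hap hns hX hP

/-- The `5`-partner of c5d:8, `W = [0, 0, 0, -4611000, 3870549250]` (non-CM, `N_W = 10411200`; `j(W) = j(A)` for the quadratic twist `A^{(8)}` of `A
= [0,0,1,−46110,3870549]` (non-CM row curve of partner conductor `162675`, `5`-CONGRUENT to a CM row — k8eta-c2 g8; CL25-transfer class, here
settled binder-free)): `Δ ≠ 0` (kernel). [cite: Zywina2015, Thm. 1.4] -/
theorem isElliptic_c5d_8 : (⟨0, 0, 0, (-4611000), 3870549250⟩ : WeierstrassCurve ℚ).IsElliptic :=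
  isElliptic_of_discOf_ne_zero 0 0 0 (-4611000) 3870549250 (by decide +kernel)

/-- **(C1⁺_η) at `p = 5` for every good `a_5 = 0` model `V` of the `5`-twist of the CONGRUENT-class prime-`L` rank-one partner c5d:8** (`W = [0, 0,
0, -4611000, 3870549250]`, non-CM, `N_W = 10411200`; kit j326606/j327196 (k8eta-c2 g21) (16+165 s, GRH): `ε(W) = −1`, PARI plus-`η` `(λ, μ) = (1,
0)`, `r_an(W) = 1` (`k8eta-c2 g19 etanc`); `h(ℚ(P)) = 20` (`[10,2]`); eigen dimensions `(d₁,d₂,d₃,d₄) = (0,1,0,0)`; Hecke datum (conjA g13 hecke13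
engine, kit j327196): `Tr ρ̄(y) = 4`, `T_y` acts on the tautological line by `c = 1` — verdict TWIST-TYPE (`T_y = −Tr`: the line belongs to `ρ̄ ⊗
ε′`, not to `ρ̄`; (c2) for `W` holds) — door L4 (Hecke-refined eigen-test) passes) from the ROW ALONE — named facts `h22 h41 h6273 hGZK`; displayed:
`r_an(W) = 1`, the tower clause, `(L_5⁺(V,η,X)) = (X)`, the class-group datum. Instance of `EtaConjADoorHeckeRecords.etaMC_r1_of_heckeEigenHom`
(p707571). CONDITIONAL; nothing booked. [cite: Kobayashi2003, §4 (p. 8), Thm. 2.2 (p. 5)] [cite: CoatesSujatha2005, §3 (A) and Thm. 3.4] [cite: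
Zywina2015, Thm. 1.4] -/
theorem etaMC_r1_c5d_8_5_of_heckeEigenHom
    (h22 : Kobayashi2003.thm22_etaSignedSelmerDual_finite_torsion)
    (h41 : Kobayashi2003.thm41_plusEtaCharIdeal_dvd)
    (h6273 : Kobayashi2003.thm62_63_73_etaColemanPoitouTate)
    (hGZK : rank_eq_analyticRank_of_analyticRank_le_one) [Fact (5 : ℕ).Prime]
    (W : WeierstrassCurve ℚ) (hW : W = (⟨0, 0, 0, (-4611000), 3870549250⟩ : WeierstrassCurve ℚ)) (hr : W.analyticRank = 1)
    (V : WeierstrassCurve ℚ) [V.IsElliptic] [V.IsGloballyMinimal] (C : VariableChange ℚ)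
    (hC : C • W.quadraticTwist 5 = V)
    (hgood : V.HasGoodReductionAtPrime 5) (hap : V.frobeniusTrace 5 = 0)
    (hns : ¬ ∀ m : ℕ, V.HasSurjectiveModNGaloisRep (5 ^ m : ℕ))
    (hX : ∀ {N : ℕ} [NeZero N] {f : CuspForm (Gamma0 N) 2}, IsNewformOf V f →
      ∀ (ϖ : ℚ), (if Even (5 / 2) then (ϖ : ℝ) * V.realPeriodRat = plusPeriod f
          else (ϖ : ℝ) * V.imaginaryPeriodRat = minusPeriod f) →
      ∀ (Lη : IwasawaAlgebra 5), IsQuadraticBranchPlusLFunction f 5 ϖ Lη →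
        Ideal.span {Lη} = Ideal.span {(PowerSeries.X : IwasawaAlgebra 5)})
    (hP : haveI : W.IsElliptic := hW ▸ isElliptic_c5d_8
      haveI : NeZero (5 : ℕ) := ⟨by norm_num⟩
      haveI : NumberField (W.divisionField 5) := NumberField.mk
      ∃ P : geomTorsion W ((5 : ℕ) : ℤ), P ≠ 0 ∧
        ∀ K : IntermediateField ℚ (W.divisionField 5),
          K = IntermediateField.fixedField
            ((MulAction.stabilizer (absoluteGaloisGroup ℚ) P).map (absRestrictNormalHom (W.divisionField 5))) →
        ∀ μ : Additive (ClassGroup (𝓞 K)) →+ ZMod 5,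
          (∀ (τ : absoluteGaloisGroup ℚ) (σ : K ≃ₐ[ℚ] K) (a : ℕ),
              (∀ x : K, absRestrictNormalHom (W.divisionField 5) τ (x : W.divisionField 5) =
                ((σ x : K) : W.divisionField 5)) → τ • P = a • P →
              ∀ (I J : (Ideal (𝓞 K))⁰),
                (J : Ideal (𝓞 K)) = (I : Ideal (𝓞 K)).map (AmbiguousClass.intAut σ : 𝓞 K →+* 𝓞 K) →
                μ (Additive.ofMul (ClassGroup.mk0 J)) = a • μ (Additive.ofMul (ClassGroup.mk0 I))) →
          (∀ (τ τ₁ : absoluteGaloisGroup ℚ) (a a₁ b : ℕ) (Q : geomTorsion W ((5 : ℕ) : ℤ)),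
              τ • P = a • P + Q → τ₁ • P = a₁ • P → τ₁ • Q = b • Q → (a₁ : ZMod 5) ≠ (b : ZMod 5) →
              ∀ I : (Ideal (𝓞 K))⁰,
                μ (Additive.ofMul (classGroupNorm K (W.divisionField 5) (ClassGroup.mulEquiv
                  (AmbiguousClass.intAut (absRestrictNormalHom (W.divisionField 5) τ))
                    (classGroupExtend K (W.divisionField 5) (ClassGroup.mk0 I))))) =
                  (Nat.card ((W.divisionField 5) ≃ₐ[K] (W.divisionField 5)) * a) •
                    μ (Additive.ofMul (ClassGroup.mk0 I))) →
          μ = 0) :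
    QuadraticBranchPlusEtaMainConjectureAt V 5 := by
  subst hW
  haveI : (⟨0, 0, 0, (-4611000), 3870549250⟩ : WeierstrassCurve ℚ).IsElliptic := isElliptic_c5d_8
  haveI : NeZero (5 : ℕ) := ⟨by norm_num⟩
  exact etaMC_r1_of_heckeEigenHom h22 h41 h6273 hGZK 5 (le_refl 5) _ hr V C
    (by rw [show ((-1 : ℚ) ^ ((5 : ℕ) / 2) * ((5 : ℕ) : ℚ)) = 5 by norm_num]; exact hC) hgood hap hns hX hP

end Summit.BirchSwinnertonDyer.BirchSwinnertonDyer.Theorems.EtaConjADoorFamilyRecords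

end
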